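import Literature.AlgebraicGeometry.ModuliOfAbelianVarieties.SiegelAdelicMarkingHoms
import Literature.AlgebraicGeometry.ModuliOfAbelianVarieties.SiegelAdelicMarkingStableLines
import HarnessLib

/-!
# The `𝔭`-family of homomorphisms between two marked abelian varieties read by `π ↦ T·M₁(π)`, with its module laws and kernel reader
# ([Milne 2005] Thm. 6.11; [Mumford 1970] §19 Thm. 3, §23; [Rapoport–Smithling–Zhang 2020] §4.3 (4.23))

Topic `AlgebraicGeometry/ModuliOfAbelianVarieties`; namespace `Literature.AlgebraicGeometry.ModuliOfAbelianVarieties.SiegelAdelicMarking`.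
THEOREMS ONLY (no definition, no named fact, no instance, no notation, no `sorry`; net Literature debt 0).  Cell `hodgecm-mathlib` (D-0151), FLOOR 0,
P6 «MOD programme» (crux hLiu418 = stmt-HodgeConjecture-24832, `--supports`, count-neutral), EHECKE closer (LA5-plan (g3) skeleton v3∕v4) organ
**(O-HF) «the `𝔭`-family of marked homomorphisms»** (DEAL L5-#9 → LA6-p02 (g2)); generic, CM-free; HC_CM is proved only modulo the printed citations until
rung 0 closes.

SETTING ([Milne2005ShimuraVarieties] §6 Thm. 6.11 p. 74: complex abelian varieties marked by points `[Jᵢ, aᵢ]` of the Siegel Shimura set, torsion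
parametrisations `uᵢ = mᵢ.r : V = ℚ^{2g} → Aᵢ(ℂ)` with kernels `Λᵢ = latticeOfGL aᵢ`).  Two marked varieties `(A₁, m₁)`, `(A₂, m₂)`; a commutative ring `R`
acting on both through endomorphisms `ιᵢ b` READING integer matrices `Mᵢ b` (`ιᵢ b (uᵢ v) = uᵢ (Mᵢ b · v)`, `Mᵢ : R →+* M_{2g}(ℤ)`); a rational matrix `T`
(«the identity of `V` in the two charts») which is `ℂ`-linear (`T_ℝ J₁ = J₂ T_ℝ`) and intertwines the readings (`T·M₁ b = M₂ b·T`); `M₁ b` `ℂ`-linear for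
`J₁`; and an ideal `𝔭 ⊆ R` with the LATTICE HYPOTHESIS `(T·M₁ π) Λ₁ ⊆ Λ₂` for `π ∈ 𝔭`.  Then ([MumfordAV1970] §19 Thm. 3 «`Hom(X, Y) → Hom(T_ℓ X, T_ℓ Y)`
is injective», Chow∕GAGA ★ `exists_hom_forall_map_r_eq_of_forall_mem`):
* §1 `exists_hom_map_r_eq_mulVec_mul` (HF-0) — for each `π ∈ 𝔭` a homomorphism `h_π : A₁ ⟶ A₂` with `h_π (u₁ v) = u₂ ((T·M₁ π) v)`.
* §2 **`exists_idealHomFamily`** (HF-1) — a GLOBAL choice `h : R → (A₁ ⟶ A₂)` reading `T·M₁ π` on `𝔭`, with the module laws as morphisms of abelian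
  varieties: `h (π + π′) = h π + h π′`, `h (x·π) = h π ≫ ι₂ x`, `ι₁ x ≫ h π = h π ≫ ι₂ x` (`π, π′ ∈ 𝔭`, `x ∈ R`; each by uniqueness on `u₁(V)`, ★
  `hom_eq_of_forall_map_r_eq`); **`exists_idealHomFamily_X`** — the same laws at the level of the underlying group-scheme morphisms
  `(h π).hom.hom.hom : A₁.X ⟶ A₂.X` (`IsMonHom`, `*` = the Hom-monoid of the commutative group object `A₂.X`), the currency of ★
  `AbelianSchemeOver.exists_roof_of_idealHomFamily(_of_isAlgClosed)` ([RapoportSmithlingZhang2020Diagonal] (4.23): the Serre-tensor roof `A₁ → A₂ ⊗ 𝔟 ← A₂`).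
* §3 **`forall_map_idealHomFamily_eq_one_iff`** (HF-2) — KERNEL READER: `(∀ π ∈ 𝔭, h_π P = 1) ↔ ∃ v, u₁ v = P ∧ ∀ π ∈ 𝔭, (T·M₁ π) v ∈ Λ₂`, when some
  `T·M₁ π₀` (`π₀ ∈ 𝔭`) is invertible (★ `forall_map_eq_one_and_forall_iff` with an empty endomorphism family).

## References
* [Milne2005ShimuraVarieties] J. S. Milne, *Introduction to Shimura varieties* (2005), §6 Thm. 6.11 p. 74 and p. 75.
* [MumfordAV1970] D. Mumford, *Abelian Varieties* (1970), §19 Thm. 3 (p. 176) and first paragraph of §19, §23 (p. 231), §7 Thm. 4 (p. 72).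
* [RapoportSmithlingZhang2020Diagonal] M. Rapoport, B. Smithling, W. Zhang, Compos. Math. 156 (2020), §4.3 (4.23) (p. 21).

#harness_tags algebraic_geometry.abelian_varieties, number_theory.shimura_varieties
-/

set_option autoImplicit false

noncomputable section

open CategoryTheory AlgebraicGeometry Matrix
open scoped MonObj
open Literature.AlgebraicGeometry.Motives (SchemeOver ComplexPoints AlgPoints specOver AbelianVariety)
open Literature.NumberTheory.Adeles (latticeOfGL)

namespace Literature.AlgebraicGeometry.ModuliOfAbelianVarieties

namespace SiegelAdelicMarking

variable {g : ℕ} {δ : Fin g → ℕ} {J₁ J₂ : C0pm δ} {a₁ a₂ : gspFinAdelic δ} {A₁ A₂ : AbelianVariety ℂ}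

/-- An integer matrix read over `ℚ` then `ℝ` is the matrix read over `ℝ`. [folklore] -/
private theorem map_intCast_map_algebraMap (M : Matrix (Fin g ⊕ Fin g) (Fin g ⊕ Fin g) ℤ) :
    (M.map (Int.cast : ℤ → ℚ)).map (algebraMap ℚ ℝ) = M.map (Int.cast : ℤ → ℝ) := by
  ext i j
  simp

/-- `(M·N)_ℚ = M_ℚ·N_ℚ` for integer matrices. [folklore] -/
private theorem map_intCast_mul (M N : Matrix (Fin g ⊕ Fin g) (Fin g ⊕ Fin g) ℤ) :
    (M * N).map (Int.cast : ℤ → ℚ) = M.map (Int.cast : ℤ → ℚ) * N.map (Int.cast : ℤ → ℚ) := by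
  ext i j
  simp [Matrix.mul_apply]

/-- `(M+N)_ℚ = M_ℚ+N_ℚ` for integer matrices. [folklore] -/
private theorem map_intCast_add (M N : Matrix (Fin g ⊕ Fin g) (Fin g ⊕ Fin g) ℤ) :
    (M + N).map (Int.cast : ℤ → ℚ) = M.map (Int.cast : ℤ → ℚ) + N.map (Int.cast : ℤ → ℚ) := by
  ext i j
  simp

/-! ### §1 (HF-0) One homomorphism per `π`: `h_π (u₁ v) = u₂ ((T·M₁ π) v)` -/

/-- **(HF-0) THE HOMOMORPHISM READING `T·M` ON THE MARKINGS**: for markings `m₁`, `m₂` of complex abelian varieties `A₁`, `A₂` by `[J₁, a₁]`, `[J₂, a₂]`, a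
rational `T` with `T_ℝ J₁ = J₂ T_ℝ`, an integer matrix `M` commuting with `J₁` over `ℝ` (`ℂ`-linearity of an endomorphism reading), and the lattice
hypothesis `(T·M) Λ₁ ⊆ Λ₂`, there is a homomorphism `h : A₁ ⟶ A₂` with `h (u₁ v) = u₂ ((T·M) v)` — ★ GAGA `exists_hom_forall_map_r_eq_of_forall_mem` at
`q := T·M`, whose `ℂ`-linearity `(T·M)_ℝ J₁ = J₂ (T·M)_ℝ` is `T_ℝ (M_ℝ J₁) = T_ℝ (J₁ M_ℝ) = (J₂ T_ℝ) M_ℝ`.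
[cite: Milne2005ShimuraVarieties, §6 Thm. 6.11 p. 74] [cite: MumfordAV1970, §19 Thm. 3 (p. 176)] -/
theorem exists_hom_map_r_eq_mulVec_mul (m₁ : SiegelAdelicMarking J₁ a₁ A₁) (m₂ : SiegelAdelicMarking J₂ a₂ A₂)
    (T : Matrix (Fin g ⊕ Fin g) (Fin g ⊕ Fin g) ℚ)
    (hTJ : T.map (algebraMap ℚ ℝ) * (J₁ : Matrix (Fin g ⊕ Fin g) (Fin g ⊕ Fin g) ℝ) =
      (J₂ : Matrix (Fin g ⊕ Fin g) (Fin g ⊕ Fin g) ℝ) * T.map (algebraMap ℚ ℝ))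
    (M : Matrix (Fin g ⊕ Fin g) (Fin g ⊕ Fin g) ℤ)
    (hMJ : M.map (Int.cast : ℤ → ℝ) * (J₁ : Matrix (Fin g ⊕ Fin g) (Fin g ⊕ Fin g) ℝ) =
      (J₁ : Matrix (Fin g ⊕ Fin g) (Fin g ⊕ Fin g) ℝ) * M.map (Int.cast : ℤ → ℝ))
    (hΛ : ∀ v ∈ latticeOfGL (a₁ : GL (Fin g ⊕ Fin g) finAdeleQ),
      (T * M.map (Int.cast : ℤ → ℚ)) *ᵥ v ∈ latticeOfGL (a₂ : GL (Fin g ⊕ Fin g) finAdeleQ)) :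
    ∃ h : A₁ ⟶ A₂, ∀ v : Fin g ⊕ Fin g → ℚ, AlgPoints.map h.hom.hom.hom (m₁.r v) = m₂.r ((T * M.map (Int.cast : ℤ → ℚ)) *ᵥ v) := by
  refine exists_hom_forall_map_r_eq_of_forall_mem m₁ m₂ (T * M.map (Int.cast : ℤ → ℚ)) ?_ hΛ
  rw [Matrix.map_mul, map_intCast_map_algebraMap, Matrix.mul_assoc, hMJ, ← Matrix.mul_assoc, hTJ, Matrix.mul_assoc]

/-! ### §2 (HF-1) The `𝔭`-family with its module laws -/

section Family

variable (m₁ : SiegelAdelicMarking J₁ a₁ A₁) (m₂ : SiegelAdelicMarking J₂ a₂ A₂)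
  {R : Type*} [CommRing R] (𝔭 : Ideal R)
  (ι₁ : R → (A₁ ⟶ A₁)) (M₁ : R →+* Matrix (Fin g ⊕ Fin g) (Fin g ⊕ Fin g) ℤ)
  (hι₁ : ∀ (b : R) (v : Fin g ⊕ Fin g → ℚ), AlgPoints.map (ι₁ b).hom.hom.hom (m₁.r v) = m₁.r ((M₁ b).map (Int.cast : ℤ → ℚ) *ᵥ v))
  (ι₂ : R → (A₂ ⟶ A₂)) (M₂ : R →+* Matrix (Fin g ⊕ Fin g) (Fin g ⊕ Fin g) ℤ)
  (hι₂ : ∀ (b : R) (v : Fin g ⊕ Fin g → ℚ), AlgPoints.map (ι₂ b).hom.hom.hom (m₂.r v) = m₂.r ((M₂ b).map (Int.cast : ℤ → ℚ) *ᵥ v))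
  (T : Matrix (Fin g ⊕ Fin g) (Fin g ⊕ Fin g) ℚ)
  (hTJ : T.map (algebraMap ℚ ℝ) * (J₁ : Matrix (Fin g ⊕ Fin g) (Fin g ⊕ Fin g) ℝ) =
    (J₂ : Matrix (Fin g ⊕ Fin g) (Fin g ⊕ Fin g) ℝ) * T.map (algebraMap ℚ ℝ))
  (hTM : ∀ b : R, T * (M₁ b).map (Int.cast : ℤ → ℚ) = (M₂ b).map (Int.cast : ℤ → ℚ) * T)
  (hMJ : ∀ b : R, (M₁ b).map (Int.cast : ℤ → ℝ) * (J₁ : Matrix (Fin g ⊕ Fin g) (Fin g ⊕ Fin g) ℝ) =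
    (J₁ : Matrix (Fin g ⊕ Fin g) (Fin g ⊕ Fin g) ℝ) * (M₁ b).map (Int.cast : ℤ → ℝ))
  (hΛ : ∀ π ∈ 𝔭, ∀ v ∈ latticeOfGL (a₁ : GL (Fin g ⊕ Fin g) finAdeleQ),
    (T * (M₁ π).map (Int.cast : ℤ → ℚ)) *ᵥ v ∈ latticeOfGL (a₂ : GL (Fin g ⊕ Fin g) finAdeleQ))

include hι₁ hι₂ hTJ hTM hMJ hΛ in
/-- **(HF-1) THE `𝔭`-FAMILY OF MARKED HOMOMORPHISMS AND ITS MODULE LAWS.**  In the setting of the module docstring there is a map `h : R → (A₁ ⟶ A₂)`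
(values off `𝔭` unconstrained) such that for `π, π′ ∈ 𝔭` and `x ∈ R`: (read) `h π (u₁ v) = u₂ ((T·M₁ π) v)`; (add) `h (π + π′) = h π + h π′`; (lin)
`h (x·π) = h π ≫ ι₂ x`; (eq) `ι₁ x ≫ h π = h π ≫ ι₂ x` — each law by uniqueness of homomorphisms on the torsion `u₁(V)` (★ `hom_eq_of_forall_map_r_eq`,
[MumfordAV1970] §19 Thm. 3) after reading both sides through the markings (`T·M₁(π+π′) = T·M₁π + T·M₁π′`, `T·M₁(xπ) = M₂x·(T·M₁π)` by `T M₁ = M₂ T`,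
`(T·M₁π)·M₁x = M₂x·(T·M₁π)` by commutativity of `R`).
[cite: Milne2005ShimuraVarieties, §6 Thm. 6.11 p. 74] [cite: MumfordAV1970, §19 Thm. 3 (p. 176) and §19 (first paragraph)] [cite: RapoportSmithlingZhang2020Diagonal, §4.3 (4.23) (p. 21)] -/
theorem exists_idealHomFamily :
    ∃ h : R → (A₁ ⟶ A₂),
      (∀ π ∈ 𝔭, ∀ v : Fin g ⊕ Fin g → ℚ,
        AlgPoints.map (h π).hom.hom.hom (m₁.r v) = m₂.r ((T * (M₁ π).map (Int.cast : ℤ → ℚ)) *ᵥ v)) ∧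
      (∀ π ∈ 𝔭, ∀ π' ∈ 𝔭, h (π + π') = h π + h π') ∧
      (∀ (x : R), ∀ π ∈ 𝔭, h (x * π) = h π ≫ ι₂ x) ∧
      (∀ (x : R), ∀ π ∈ 𝔭, ι₁ x ≫ h π = h π ≫ ι₂ x) := by
  classical
  have H0 : ∀ π, π ∈ 𝔭 → ∃ h : A₁ ⟶ A₂, ∀ v : Fin g ⊕ Fin g → ℚ,
      AlgPoints.map h.hom.hom.hom (m₁.r v) = m₂.r ((T * (M₁ π).map (Int.cast : ℤ → ℚ)) *ᵥ v) :=
    fun π hπ => exists_hom_map_r_eq_mulVec_mul m₁ m₂ T hTJ (M₁ π) (hMJ π) (hΛ π hπ)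
  choose! h hh using H0
  -- the readings of the three composite shapes
  have hadd_read : ∀ π ∈ 𝔭, ∀ π' ∈ 𝔭, ∀ v : Fin g ⊕ Fin g → ℚ,
      AlgPoints.map (h π + h π').hom.hom.hom (m₁.r v) = m₂.r ((T * (M₁ (π + π')).map (Int.cast : ℤ → ℚ)) *ᵥ v) := by
    intro π hπ π' hπ' v
    rw [Literature.AlgebraicGeometry.Motives.AbelianVariety.map_hom_add, hh π hπ, hh π' hπ', ← m₂.r_add, map_add,
      map_intCast_add, Matrix.mul_add, Matrix.add_mulVec]
  have hlin_read : ∀ (x : R), ∀ π ∈ 𝔭, ∀ v : Fin g ⊕ Fin g → ℚ,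
      AlgPoints.map (h π ≫ ι₂ x).hom.hom.hom (m₁.r v) = m₂.r ((T * (M₁ (x * π)).map (Int.cast : ℤ → ℚ)) *ᵥ v) := by
    intro x π hπ v
    rw [Literature.AlgebraicGeometry.Motives.AbelianVariety.map_hom_comp, hh π hπ, hι₂, Matrix.mulVec_mulVec, map_mul, map_intCast_mul,
      ← Matrix.mul_assoc, ← hTM x, Matrix.mul_assoc]
  refine ⟨h, hh, fun π hπ π' hπ' => ?_, fun x π hπ => ?_, fun x π hπ => ?_⟩
  · -- (add)
    refine hom_eq_of_forall_map_r_eq m₁ _ _ fun v => ?_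
    rw [hh (π + π') (𝔭.add_mem hπ hπ'), hadd_read π hπ π' hπ' v]
  · -- (lin)
    refine hom_eq_of_forall_map_r_eq m₁ _ _ fun v => ?_
    rw [hh (x * π) (𝔭.mul_mem_left x hπ), hlin_read x π hπ v]
  · -- (eq): both sides read `T·M₁(xπ) = T·M₁(πx)`
    refine hom_eq_of_forall_map_r_eq m₁ _ _ fun v => ?_
    rw [hlin_read x π hπ v, Literature.AlgebraicGeometry.Motives.AbelianVariety.map_hom_comp, hι₁, hh π hπ, Matrix.mulVec_mulVec,
      mul_comm x π, map_mul, map_intCast_mul, Matrix.mul_assoc]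

include hι₁ hι₂ hTJ hTM hMJ hΛ in
/-- **(HF-1, X-LEVEL) THE SAME FAMILY, LAWS ON THE UNDERLYING GROUP-SCHEME MORPHISMS `(h π).hom.hom.hom : A₁.X ⟶ A₂.X`** — the currency of ★
`AbelianSchemeOver.exists_roof_of_idealHomFamily` (`hmon hadd hlin heq`): (mon) each is a homomorphism of group objects (`IsMonHom`); (add)
`(h (π+π′)) = (h π) * (h π′)` in the Hom-monoid of the commutative group object `A₂.X` (addition of homomorphisms IS that product, ★
`Motives.AbelianVariety.hom_add`); (lin) `(h (x·π)) = (h π) ≫ (ι₂ x)`; (eq) `(ι₁ x) ≫ (h π) = (h π) ≫ (ι₂ x)`; plus the reading.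
[cite: Milne2005ShimuraVarieties, §6 Thm. 6.11 p. 74] [cite: MumfordAV1970, §19 Thm. 3 (p. 176) and §19 (first paragraph)] [cite: RapoportSmithlingZhang2020Diagonal, §4.3 (4.23) (p. 21)] -/
theorem exists_idealHomFamily_X :
    ∃ h : R → (A₁ ⟶ A₂),
      (∀ π ∈ 𝔭, ∀ v : Fin g ⊕ Fin g → ℚ,
        AlgPoints.map (h π).hom.hom.hom (m₁.r v) = m₂.r ((T * (M₁ π).map (Int.cast : ℤ → ℚ)) *ᵥ v)) ∧
      (∀ π ∈ 𝔭, IsMonHom (h π).hom.hom.hom) ∧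
      (∀ π ∈ 𝔭, ∀ π' ∈ 𝔭, (h (π + π')).hom.hom.hom = (h π).hom.hom.hom * (h π').hom.hom.hom) ∧
      (∀ (x : R), ∀ π ∈ 𝔭, (h (x * π)).hom.hom.hom = (h π).hom.hom.hom ≫ (ι₂ x).hom.hom.hom) ∧
      (∀ (x : R), ∀ π ∈ 𝔭, (ι₁ x).hom.hom.hom ≫ (h π).hom.hom.hom = (h π).hom.hom.hom ≫ (ι₂ x).hom.hom.hom) := by
  obtain ⟨h, hh, hadd, hlin, heq⟩ := exists_idealHomFamily m₁ m₂ 𝔭 ι₁ M₁ hι₁ ι₂ M₂ hι₂ T hTJ hTM hMJ hΛ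
  refine ⟨h, hh, fun π _ => inferInstance, fun π hπ π' hπ' => ?_, fun x π hπ => ?_, fun x π hπ => ?_⟩
  · rw [hadd π hπ π' hπ']
    rfl
  · rw [hlin x π hπ]
    rfl
  · exact congrArg (fun f : A₁ ⟶ A₂ => f.hom.hom.hom) (heq x π hπ)

end Family

/-! ### §3 (HF-2) The kernel reader of the family -/

/-- **(HF-2) KERNEL READER OF A FAMILY READING `π ↦ q π` ON `𝔭`**: if `h π (u₁ v) = u₂ (q π · v)` for `π ∈ 𝔭` and some `q π₀` (`π₀ ∈ 𝔭`) is invertible, then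
a point `P ∈ A₁(ℂ)` is killed by every `h π`, `π ∈ 𝔭`, iff `P = u₁ v` with `q π · v ∈ Λ₂` for all `π ∈ 𝔭` (★ `forall_map_eq_one_and_forall_iff` with the
empty endomorphism family; [Milne2005ShimuraVarieties] p. 75 «`V/Λ ≅ V(𝔸_f)/Λ̂`», [MumfordAV1970] §7 Thm. 4).  For (HF-1) take `q π := T·M₁ π`.
[cite: Milne2005ShimuraVarieties, §6 Thm. 6.11 p. 74 and p. 75] [cite: MumfordAV1970, §7 Thm. 4 (p. 72)] -/
theorem forall_map_idealHomFamily_eq_one_iff (m₁ : SiegelAdelicMarking J₁ a₁ A₁) (m₂ : SiegelAdelicMarking J₂ a₂ A₂)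
    {R : Type*} (𝔭 : Set R) (h : R → (A₁ ⟶ A₂)) (q : R → Matrix (Fin g ⊕ Fin g) (Fin g ⊕ Fin g) ℚ)
    (hh : ∀ π ∈ 𝔭, ∀ v : Fin g ⊕ Fin g → ℚ, AlgPoints.map (h π).hom.hom.hom (m₁.r v) = m₂.r (q π *ᵥ v))
    {π₀ : R} (hπ₀ : π₀ ∈ 𝔭) (q₀ : GL (Fin g ⊕ Fin g) ℚ)
    (hq₀ : ((q₀ : GL (Fin g ⊕ Fin g) ℚ) : Matrix (Fin g ⊕ Fin g) (Fin g ⊕ Fin g) ℚ) = q π₀) (P : A₁.Points ℂ) :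
    (∀ π ∈ 𝔭, AlgPoints.map (h π).hom.hom.hom P = 1) ↔
      ∃ v : Fin g ⊕ Fin g → ℚ, m₁.r v = P ∧ ∀ π ∈ 𝔭, q π *ᵥ v ∈ latticeOfGL (a₂ : GL (Fin g ⊕ Fin g) finAdeleQ) := by
  have H := forall_map_eq_one_and_forall_iff m₁ m₂ 𝔭 h q hh hπ₀ q₀ hq₀ (∅ : Set R) (fun _ => 𝟙 A₁) (fun _ => 1)
    (fun b hb => absurd hb (Set.notMem_empty b)) P
  constructor
  · intro hP
    obtain ⟨v, hv, h1, -⟩ := H.1 ⟨hP, fun b hb => absurd hb (Set.notMem_empty b)⟩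
    exact ⟨v, hv, h1⟩
  · rintro ⟨v, hv, h1⟩
    exact (H.2 ⟨v, hv, h1, fun b hb => absurd hb (Set.notMem_empty b)⟩).1

end SiegelAdelicMarking

end Literature.AlgebraicGeometry.ModuliOfAbelianVarieties

end
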